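import Mathlib
import Summits.NavierStokesRegularity.NavierStokesRegularity.Theorems.EulerZoomLiouvillePowerGaugeEulerLiouvilleCondenserRadialMomentum
import Summits.NavierStokesRegularity.NavierStokesRegularity.Theorems.EulerZoomLiouvillePowerGaugeEulerLiouvilleCondenserSliceReduction

/-!
# THE SLICE RADIAL-MOMENTUM IDENTITY OF A SELF-SIMILAR EULER PROFILE — the instrument's entry point ((SR) ∘ (I), nsreg-p2
ROUND-47 «WHO HOLDS THE RIDGE»; exact infrastructure)

Width piece for crux `EulerZoomLiouville.PowerGaugeEulerLiouville` (stmt-NavierStokesRegularity-19832), by name under LEAD 19832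
(ns-typeII-p2 g14) and planner nsreg-p2 g37 (01:07:16Z: the RMI chain is an INSTRUMENT for future per-slice arguments); seat
ns-ezl-w2 g5, `--supports stmt-NavierStokesRegularity-19832 --as helper`.

One call instead of two: for every self-similar Euler profile `IsSelfSimilarEulerProfile γ 0 V P` (`V ∈ C²`, `P ∈ C¹`, profile equation,
`div V = 0`), every base point `y ∈ ℝ³` and all radii `0 < δ ≤ d`, the slice radial-momentum identity (I)
`Condenser.sliceRadialMomentumIdentity_of` (p684023) holds for the slice data of (SR) `Condenser.sliceReduction_of` (p685130) on the
coordinate slice `{x₂ = y₂}` charted by `Φ_y z = y + z.re•e₀ + z.im•e₁`: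
`p = P∘Φ_y`, `v = ((V∘Φ_y)₀, (V∘Φ_y)₁) ∈ ℂ`, `w = γy₂ + (V∘Φ_y)₂`, `a = ((DV e₂)₀,(DV e₂)₁)∘Φ_y`, `b = (DV e₂)₂∘Φ_y`, `ζ₀ = (y₀,y₁)`.

* `sliceRadialMomentumIdentity_of_profile` — the composite, all slice data written out as explicit functions of `(V, P, y)`.

HONEST FRAMING: exact slice calculus; proves nothing about the crux E (19832 OPEN), any door Target, or Navier–Stokes regularity; no
summit statement is touched. [folklore]
-/

noncomputable section

open Set Filter Topology Metric Function MeasureTheory Complex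
open scoped Real RealInnerProductSpace

set_option linter.dupNamespace false

namespace Summit.NavierStokesRegularity.NavierStokesRegularity.Theorems.PowerGaugeEulerLiouville.Condenser

open Literature.Analysis Literature.Analysis.FluidPDE

/-- **THE SLICE RADIAL-MOMENTUM IDENTITY OF A SELF-SIMILAR EULER PROFILE** ((SR) then (I)).  For
`IsSelfSimilarEulerProfile γ 0 V P`, `y ∈ ℝ³`, `0 < δ ≤ d`, with `Φ z = y + z.re•e₀ + z.im•e₁`, `v z = ((V(Φz))₀, (V(Φz))₁)`,
`v_r = ⟪v, r̂⟫`, `v_θ = ⟪v, θ̂⟫`: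
`⨍_{S_δ}(P∘Φ + v_r²) − ⨍_{S_d}(P∘Φ + v_r²) = (1−2γ)(2π)⁻¹∫∫ v_r + γ(d⨍_{S_d}v_r − δ⨍_{S_δ}v_r) + (2π)⁻¹∫∫ (γy₂ + V(Φ)₂)⟪(DV e₂)_⊥, r̂⟫`
`   + γ(2π)⁻¹∫∫⟪Dv[(y₀,y₁)], r̂⟫ + (2π)⁻¹∫∫ v_r (DV e₂)₂ + (2π)⁻¹∫ ρ⁻¹∫ (v_r² − v_θ²)`. [folklore] -/
theorem sliceRadialMomentumIdentity_of_profile {γ : ℝ} {V : EuclideanSpace ℝ (Fin 3) → EuclideanSpace ℝ (Fin 3)}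
    {P : EuclideanSpace ℝ (Fin 3) → ℝ} (hprof : IsSelfSimilarEulerProfile γ 0 V P) (y : EuclideanSpace ℝ (Fin 3))
    {δ d : ℝ} (hδ : 0 < δ) (hδd : δ ≤ d) :
    let Φ : ℂ → EuclideanSpace ℝ (Fin 3) := fun z =>
      y + z.re • EuclideanSpace.basisFun (Fin 3) ℝ 0 + z.im • EuclideanSpace.basisFun (Fin 3) ℝ 1
    let p : ℂ → ℝ := fun z => P (Φ z)
    let v : ℂ → ℂ := fun z => Complex.mk (V (Φ z) 0) (V (Φ z) 1)
    let w : ℂ → ℝ := fun z => γ * y 2 + V (Φ z) 2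
    let a : ℂ → ℂ := fun z => Complex.mk (fderiv ℝ V (Φ z) (EuclideanSpace.basisFun (Fin 3) ℝ 2) 0)
      (fderiv ℝ V (Φ z) (EuclideanSpace.basisFun (Fin 3) ℝ 2) 1)
    let b : ℂ → ℝ := fun z => fderiv ℝ V (Φ z) (EuclideanSpace.basisFun (Fin 3) ℝ 2) 2
    (Real.circleAverage p 0 δ + Real.circleAverage (fun z : ℂ => ⟪v z, (‖z‖⁻¹ : ℝ) • z⟫ ^ 2) 0 δ) -
        (Real.circleAverage p 0 d + Real.circleAverage (fun z : ℂ => ⟪v z, (‖z‖⁻¹ : ℝ) • z⟫ ^ 2) 0 d) =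
      (1 - 2 * γ) * ((2 * Real.pi)⁻¹ * (∫ ρ in δ..d, ∫ θ in (0 : ℝ)..2 * Real.pi,
          ⟪v (circleMap 0 ρ θ), circleMap 0 1 θ⟫)) +
        γ * (d * Real.circleAverage (fun z : ℂ => ⟪v z, (‖z‖⁻¹ : ℝ) • z⟫) 0 d -
            δ * Real.circleAverage (fun z : ℂ => ⟪v z, (‖z‖⁻¹ : ℝ) • z⟫) 0 δ) +
        (2 * Real.pi)⁻¹ * (∫ ρ in δ..d, ∫ θ in (0 : ℝ)..2 * Real.pi,
          w (circleMap 0 ρ θ) * ⟪a (circleMap 0 ρ θ), circleMap 0 1 θ⟫) +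
        γ * ((2 * Real.pi)⁻¹ * (∫ ρ in δ..d, ∫ θ in (0 : ℝ)..2 * Real.pi,
          ⟪fderiv ℝ v (circleMap 0 ρ θ) (Complex.mk (y 0) (y 1)), circleMap 0 1 θ⟫)) +
        (2 * Real.pi)⁻¹ * (∫ ρ in δ..d, ∫ θ in (0 : ℝ)..2 * Real.pi,
          ⟪v (circleMap 0 ρ θ), circleMap 0 1 θ⟫ * b (circleMap 0 ρ θ)) +
        (2 * Real.pi)⁻¹ * (∫ ρ in δ..d, ρ⁻¹ * ∫ θ in (0 : ℝ)..2 * Real.pi,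
          (⟪v (circleMap 0 ρ θ), circleMap 0 1 θ⟫ ^ 2 -
            ⟪v (circleMap 0 ρ θ), circleMap 0 1 θ * I⟫ ^ 2)) := by
  intro Φ p v w a b
  obtain ⟨hp1, hv1, hac, hwc, hbc, hpeq, hdiv⟩ :=
    sliceReduction_of hprof y (p := p) (v := v) (a := a) (w := w) (b := b)
      (fun _ => rfl) (fun _ => rfl) (fun _ => rfl) (fun _ => rfl) (fun _ => rfl)
  exact sliceRadialMomentumIdentity_of hp1 hv1 hac hwc hbc hpeq hdiv hδ hδd

end Summit.NavierStokesRegularity.NavierStokesRegularity.Theorems.PowerGaugeEulerLiouville.Condenser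

end
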